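import Summits.ABC.IUTFork.Joshi.AdelicAnsatzPeriodScaling
import HarnessLib

/-!
# [J-III] Cor. 4.2.2.4 / Thm. 4.6.1 (4) OUTRIGHT — "renormalization IS forced": the closing step over the signature, leaving
# only a number-field witness (block E, T-08; the second DERIVABLE row named by the T-07 author's read of p429842)

Proof-only companion (abc-iut cell, block E, rung LADDER-ABC:A2.E; seat abc-iut-E-t8) of `Joshi/AdelicAnsatzPeriodScaling.lean`
(p429842: `ArithPeriodDatum.renormalization_forced` — [J-III] arXiv:2401.13508v4 Thm. 4.6.1 (4) p.37 l.19–26 / Cor. 4.2.2.4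
p.33 l.81–p.34 l.11 in CONTRAPOSITIVE form: same normalization coordinate at `y_1` and `y_j` (`j ≥ 2`) + both product formulas +
the scaling (4.2.2.2)/(4.2.2.3) ⟹ every `x ∈ L′^*` has `Σ_{w ∈ V^{odd,ss}} α_w · log|x|_{K_{y_1,w}} = 0`, with the final step "absurd
for a number field and a nonempty finite set of finite places" explicitly left unasserted there). The T-07 author's typer-side read
(abc-iut-E-t7, STATUS 08:11:27Z) named that final step a DERIVABLE-at-instantiation row. This file proves it OVER THE SIGNATURE
down to a single witness: if `y_1` is standardly normalised ([J-IIh] (5.3.3), `IsStdNormalized`) and some `x ∈ L′^*` is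
`|−|_w`-INTEGRAL at every `w ∈ V^{odd,ss}` and a NON-UNIT at one `w₀ ∈ V^{odd,ss}` (for a number field and finite places: any
non-zero element of the prime `𝔭_{w₀}` — the only input left to an instantiation seat, a Mathlib `NumberField` /
`IsDedekindDomain.HeightOneSpectrum` fact, not asserted here), then `Σ_{w ∈ V^{odd,ss}} α_w · log|x|_{K_{y_1,w}} = Σ_{w} log|x|_w < 0`,
so the conclusion of `renormalization_forced` is violated and the normalization coordinates of `y_j` and `y_1` DIFFER
(`alpha_ne_of_scaling`) — print's "suitable (re)normalization of valuations must be introduced" (Cor. 4.2.2.4), now a kernel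
statement conditional only on T-07's scaling predicates and the two product formulas. Kernel glue; no Joshi claim asserted (the
scaling enters as the hypothesis predicates `ScalingOnL`/`DiagonalOnL` = T-07's `ValuationScaling`/`ValuationConstantOffSS`
restricted to `L′`); TAKES NO SIDE on [IUTchIII] Cor. 3.12 or on any author; typed ≠ proved. No `Cor312*`/`Thm311*` import
(E-PLAN R14). Standard axioms; sorry-free.
-/

noncomputable section

open Set Finset

namespace Summit.ABC.IUTFork.Joshi

namespace ArithPeriodDatum

variable {L : Type} [Field L] (D : ArithPeriodDatum L)

/-- Under standard normalisation of `y` ([J-IIh] (5.3.3)), the `α`-weighted logarithm at `w` of the diagonal image of `x ∈ L′^*`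
is the logarithm of the STANDARD absolute value: `α_{y,w} · log|x|_{K_{y_w}} = log|x|_w`. [folklore] -/
theorem alpha_mul_logMap_emb {y : D.AdelicPoint} (hy : D.IsStdNormalized y) (x : Lˣ) (w : D.V) :
    D.logMap y (D.embIdeloid y x) w * D.α y w = Real.log (D.stdAbs w (x : L)) := by
  rw [logMap_apply]
  simp only [embIdeloid, embUnits_apply]
  have hr : 0 < D.abs w (y w) (D.emb w (y w) (x : L)) :=
    (D.abs w _).pos ((map_ne_zero_iff _ (D.emb w (y w)).injective).2 x.ne_zero)
  rw [← hy w (x : L), Real.log_rpow hr, mul_comm]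

open Classical in
/-- The `α`-degree of `x ∈ L′^*` on `V^{odd,ss}` (the quantity `renormalization_forced` forces to vanish), rewritten under standard
normalisation of `y_1` as the finite sum `Σ_w log|x|_w` over the bad places where `x` is not a `K_{y_1,w}`-unit. [folklore] -/
theorem degFunctional_filter_eq_sum_log {y : D.AdelicPoint} (hy : D.IsStdNormalized y) (x : Lˣ) :
    D.degFunctional y ((D.logMap y (D.embIdeloid y x)).filter (· ∈ D.Voddss)) =
      ∑ w ∈ ((D.logMap y (D.embIdeloid y x)).filter (· ∈ D.Voddss)).support, Real.log (D.stdAbs w (x : L)) := by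
  rw [degFunctional_apply, Finsupp.sum]
  refine Finset.sum_congr rfl fun w hw => ?_
  have hwS : w ∈ D.Voddss := by
    rw [Finsupp.support_filter, Finset.mem_filter] at hw
    exact hw.2
  rw [Finsupp.filter_apply_pos _ _ hwS, D.alpha_mul_logMap_emb hy x w]

open Classical in
/-- **Cor. 4.2.2.4 / Thm. 4.6.1 (4), OUTRIGHT over the signature.** With the scaling (4.2.2.2)/(4.2.2.3) on `L′`, both product
formulas, `y_1` standardly normalised, and ONE element `x ∈ L′^*` that is `|−|_w`-integral at every bad place and a non-unit at some
bad place `w₀` (number-field witness: `0 ≠ x ∈ 𝔭_{w₀}`), the normalization coordinates of `y_j` (`j ≥ 2`) and `y_1` are DIFFERENT —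
"suitable (re)normalization of valuations must be introduced at primes `w ∈ V_{L′} − V^{odd,ss}`" ([J-III] Cor. 4.2.2.4, p.33
l.81–p.34 l.1; by `alpha_scaling` they already differ ON `V^{odd,ss}` under standard normalisation of both). Conditional on T-07's
scaling predicates; no side taken. [folklore] -/
theorem alpha_ne_of_scaling {z : D.Tuple} (hsc : D.ScalingOnL z) (hdiag : D.DiagonalOnL z) {i : Fin D.lstar}
    (hi : i ≠ D.first) (h1 : D.IsNormalized (z D.first)) (hj : D.IsNormalized (z i))
    (hstd : D.IsStdNormalized (z D.first)) {w₀ : D.V} (hw₀ : w₀ ∈ D.Voddss) {x : Lˣ}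
    (hx₀ : D.stdAbs w₀ (x : L) < 1) (hx : ∀ w ∈ D.Voddss, D.stdAbs w (x : L) ≤ 1) :
    D.α (z i) ≠ D.α (z D.first) := by
  intro hα
  have h0 := D.renormalization_forced hsc hdiag hi h1 hj hα x
  rw [D.degFunctional_filter_eq_sum_log hstd x] at h0
  -- the support of the restricted log vector contains `w₀`
  set l := (D.logMap (z D.first) (D.embIdeloid (z D.first) x)).filter (· ∈ D.Voddss) with hl
  have hx₀pos : 0 < D.stdAbs w₀ (x : L) := (D.stdAbs w₀).pos x.ne_zero
  have hlog₀ : Real.log (D.stdAbs w₀ (x : L)) < 0 := Real.log_neg hx₀pos hx₀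
  have hmem : w₀ ∈ l.support := by
    rw [Finsupp.mem_support_iff, hl, Finsupp.filter_apply_pos _ _ hw₀]
    intro h00
    have := D.alpha_mul_logMap_emb hstd x w₀
    rw [h00, zero_mul] at this
    exact hlog₀.ne this.symm
  -- every summand is `≤ 0`, the one at `w₀` is `< 0`
  have hle : ∀ w ∈ l.support, Real.log (D.stdAbs w (x : L)) ≤ 0 := by
    intro w hw
    have hwS : w ∈ D.Voddss := by
      rw [hl, Finsupp.support_filter, Finset.mem_filter] at hw
      exact hw.2
    exact Real.log_nonpos ((D.stdAbs w).nonneg _) (hx w hwS)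
  have hsum : ∑ w ∈ l.support, Real.log (D.stdAbs w (x : L)) < 0 := by
    rw [← Finset.add_sum_erase _ _ hmem]
    have hrest : ∑ w ∈ l.support.erase w₀, Real.log (D.stdAbs w (x : L)) ≤ 0 :=
      Finset.sum_nonpos fun w hw => hle w (Finset.mem_of_mem_erase hw)
    linarith
  exact hsum.ne h0

end ArithPeriodDatum

end Summit.ABC.IUTFork.Joshi

end
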